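import Literature.Topology.PlaneTopology.JordanCurveProofs
import Literature.Probability.RandomPlanarGeometry.PlanarDomainsTopology
import Literature.Probability.RandomPlanarGeometry.JordanBoundaryLemmas
import HarnessLib

/-!
# The boundary loop of a Jordan domain winds around its points; degree of reparametrised loops

Topic `Literature/Probability/RandomPlanarGeometry`; theorems only (no definition, no named
fact). Two winding-number tools for recognising points INSIDE the polygonal domains approximating
a Jordan domain (the kernel property (K1) of the face domains of lattice discretisations,
`LatticeModels.DiscreteDobrushin.faceDomain`, via Rouché against the boundary loop):

* `JordanDomain.wind_boundary_sub_ne_zero` — **the boundary loop of a Jordan domain has non-zero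
  winding number about every point of the domain**: the complementary component of such a point
  is the (bounded) domain itself (`connectedComponentIn_compl_frontier_eq`), so `z ↦ z - a` has no
  logarithm on the curve (Eilenberg's criterion, `not_hasLogOn_sub` of `EilenbergCriterion.lean`),
  i.e. the winding number of the parametrisation is non-zero (`hasLogOn_iff_wind_eq_zero` of
  `JordanCurveProofs.lean`, transported along `exists_homeomorph_param_eq`);
* `wind_comp_eq_mul_of_periodic` — **degree of a reparametrised periodic loop**: for a continuous
  `1`-periodic nonvanishing `g` and a continuous `Λ : [0, 1] → ℝ` with `Λ 1 = Λ 0 + m`, `m ∈ ℤ`,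
  `wind (g ∘ Λ) = m · wind g` (a logarithm of `g` on `[0, 1]` extends to `ℝ` by
  `L (fract t) + ⌊t⌋ · 2πi · wind g`; composed with `Λ` it is a logarithm of `g ∘ Λ` whose
  increment is `m · 2πi · wind g`).

Both folklore; McCleary, *A First Course in Topology* (2006), Ch. 9 for the Jordan curve theorem
used (tree: `JordanCurveTheorem_holds`).

## References

* J. McCleary, *A First Course in Topology: Continuity and Dimension*, AMS (2006), Ch. 9.
  [Mccleary2006]
* S. Eilenberg, *Transformations continues en circonférence et la topologie du plan*, Fund. Math.
  26 (1936). [Eilenberg1936]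
-/

noncomputable section

open Set Function Complex Filter Metric
open _root_.Topology
open Literature.Topology.PlaneTopology Literature.Topology.PlaneTopology.JordanCurveProof

namespace Literature.Probability.RandomPlanarGeometry

namespace JordanDomain

variable (D : JordanDomain)

/-- **The boundary loop as a homeomorphism from the circle**, with its values: there is
`e : ℝ/ℤ ≃ₜ ∂D` whose periodic parametrisation `param e` IS the boundary loop (the construction of
`range_homeomorphic_addCircle`, with the values recorded). [folklore] -/
theorem exists_homeomorph_param_eq :
    ∃ e : AddCircle (1 : ℝ) ≃ₜ frontier D.carrier, ∀ t, param e t = D.boundary t := by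
  haveI : Fact ((0 : ℝ) < 1) := ⟨one_pos⟩
  set γ := D.boundary with hγ
  set f : AddCircle (1 : ℝ) → ℂ := AddCircle.liftIco 1 0 γ with hf
  have hfc : Continuous f := AddCircle.liftIco_zero_continuous
    (by simpa using (D.periodic_boundary 0).symm) D.continuous_boundary.continuousOn
  have hfapply : ∀ x : ℝ, x ∈ Ico (0 : ℝ) 1 → f (x : AddCircle (1 : ℝ)) = γ x := fun x hx =>
    AddCircle.liftIco_coe_apply (by simpa using hx)
  have hfper : ∀ x : ℝ, f (x : AddCircle (1 : ℝ)) = γ x := by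
    intro x
    have h1 : ((Int.fract x : ℝ) : AddCircle (1 : ℝ)) = (x : AddCircle (1 : ℝ)) := by
      rw [Int.fract, AddCircle.coe_sub]
      simp
    rw [← h1, hfapply _ ⟨Int.fract_nonneg x, Int.fract_lt_one x⟩]
    exact D.boundary_fract x
  have hfinj : Function.Injective f := by
    intro a b hab
    obtain ⟨x, hx, rfl⟩ : ∃ x ∈ Ico (0 : ℝ) 1, (x : AddCircle (1 : ℝ)) = a :=
      ⟨(AddCircle.equivIco 1 0 a : ℝ), by simpa using (AddCircle.equivIco 1 0 a).2,
        AddCircle.coe_equivIco⟩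
    obtain ⟨y, hy, rfl⟩ : ∃ y ∈ Ico (0 : ℝ) 1, (y : AddCircle (1 : ℝ)) = b :=
      ⟨(AddCircle.equivIco 1 0 b : ℝ), by simpa using (AddCircle.equivIco 1 0 b).2,
        AddCircle.coe_equivIco⟩
    rw [hfapply x hx, hfapply y hy] at hab
    rw [D.injOn_boundary hx hy hab]
  have hrange : range f = frontier D.carrier := by
    rw [← D.range_boundary]
    ext z
    constructor
    · rintro ⟨a, rfl⟩
      obtain ⟨x, -, rfl⟩ : ∃ x ∈ Ico (0 : ℝ) 1, (x : AddCircle (1 : ℝ)) = a :=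
        ⟨(AddCircle.equivIco 1 0 a : ℝ), by simpa using (AddCircle.equivIco 1 0 a).2,
          AddCircle.coe_equivIco⟩
      exact ⟨x, (hfper x).symm⟩
    · rintro ⟨t, rfl⟩
      exact ⟨(t : AddCircle (1 : ℝ)), hfper t⟩
  have hemb : Topology.IsEmbedding f := (hfc.isClosedEmbedding hfinj).isEmbedding
  refine ⟨hemb.toHomeomorph.trans (Homeomorph.setCongr hrange), fun t => ?_⟩
  show ((hemb.toHomeomorph.trans (Homeomorph.setCongr hrange)) (t : AddCircle (1 : ℝ)) : ℂ) = D.boundary t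
  rw [Homeomorph.trans_apply]
  change ((hemb.toHomeomorph (t : AddCircle (1 : ℝ))) : ℂ) = D.boundary t
  rw [Topology.IsEmbedding.toHomeomorph_apply_coe]
  exact hfper t

/-- **The complementary component of an interior point is the domain.** [folklore] -/
theorem connectedComponentIn_compl_frontier_eq {z : ℂ} (hz : z ∈ D.carrier) :
    connectedComponentIn (frontier D.carrier)ᶜ z = D.carrier := by
  refine Subset.antisymm ?_ ?_
  · obtain ⟨V, hVo, -, hDV, hunion, -, -⟩ := D.exists_outside JordanCurveTheorem_holds
    refine isPreconnected_connectedComponentIn.subset_left_of_subset_union D.isOpen hVo hDV ?_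
      ⟨z, mem_connectedComponentIn ?_, hz⟩
    · rw [hunion]; exact connectedComponentIn_subset _ _
    · exact fun h => Set.disjoint_left.1 D.disjoint_carrier_frontier hz h
  · exact D.isConnected.isPreconnected.subset_connectedComponentIn hz
      (Set.disjoint_left.1 D.disjoint_carrier_frontier)

/-- **The boundary loop of a Jordan domain winds around each of its points**:
`wind (∂D - z) ≠ 0` for `z ∈ D`. (Eilenberg's criterion: the complementary component of `z` is the
bounded domain, so `w ↦ w - z` has no logarithm on the curve.) [cite: Mccleary2006, Ch. 9] -/
theorem wind_boundary_sub_ne_zero {z : ℂ} (hz : z ∈ D.carrier) :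
    wind (fun t => D.boundary t - z) ≠ 0 := by
  obtain ⟨e, he⟩ := D.exists_homeomorph_param_eq
  have hzK : z ∉ frontier D.carrier := fun h => Set.disjoint_left.1 D.disjoint_carrier_frontier hz h
  have hbdd : Bornology.IsBounded (connectedComponentIn (frontier D.carrier)ᶜ z) := by
    rw [D.connectedComponentIn_compl_frontier_eq hz]; exact D.isBounded
  have hnot := not_hasLogOn_sub D.isCompact_frontier hzK hbdd
  intro hw
  apply hnot
  rw [hasLogOn_iff_wind_eq_zero e (F := fun w => w - z) (by fun_prop)
    (fun w hw h0 => hzK (sub_eq_zero.1 h0 ▸ hw))]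
  have : ((fun w : ℂ => w - z) ∘ param e) = fun t => D.boundary t - z := by
    funext t; simp [Function.comp, he t]
  rw [this]
  exact hw

end JordanDomain

/-! ### Degree of a reparametrised periodic loop -/

/-- A continuous `1`-periodic nonvanishing function has a **global logarithm on `ℝ` with the
winding increment**: `L (t + 1) = L t + 2πi · wind g`, indeed `L (t + n) = L t + n · 2πi · wind g`
for `n ∈ ℤ`. [folklore] -/
theorem exists_log_of_periodic {g : ℝ → ℂ} (hg : Continuous g) (hper : Function.Periodic g 1)
    (hg0 : ∀ t, g t ≠ 0) :
    ∃ L : ℝ → ℂ, Continuous L ∧ (∀ t, exp (L t) = g t) ∧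
      ∀ (t : ℝ) (n : ℤ), L (t + n) = L t + n * (wind g * (2 * Real.pi * I)) := by
  obtain ⟨l, hl, hle⟩ := hasLogOn_Icc hg.continuousOn fun t _ => hg0 t
  have h01 : g 0 = g 1 := by simpa using (hper 0).symm
  have hspec := wind_spec hl hle h01
  set K : ℂ := wind g * (2 * Real.pi * I) with hK
  -- `G x = l x - x • K` is continuous on `[0, 1]` with `G 0 = G 1`
  set G : ℝ → ℂ := fun x => l x - (x : ℂ) * K with hG
  have hGc : ContinuousOn G (Icc 0 1) := hl.sub ((continuous_ofReal.continuousOn).mul continuousOn_const)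
  have hG01 : G 0 = G 1 := by
    simp only [hG, ofReal_zero, zero_mul, sub_zero, ofReal_one, one_mul]
    rw [sub_eq_iff_eq_add] at hspec
    rw [hspec, hK]; ring
  refine ⟨fun t => G (Int.fract t) + (t : ℂ) * K, ?_, fun t => ?_, fun t n => ?_⟩
  · exact ((hGc.comp_fract'' hG01).comp continuous_id |>.add
      (continuous_ofReal.mul continuous_const))
  · have hft : Int.fract t ∈ Icc (0 : ℝ) 1 := ⟨Int.fract_nonneg t, (Int.fract_lt_one t).le⟩
    simp only [hG]
    rw [show l (Int.fract t) - ((Int.fract t : ℝ) : ℂ) * K + (t : ℂ) * K =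
        l (Int.fract t) + ((t - Int.fract t : ℝ) : ℂ) * K by push_cast; ring, exp_add, hle _ hft]
    rw [show t - Int.fract t = (⌊t⌋ : ℝ) by rw [Int.fract]; ring]
    have : exp (((⌊t⌋ : ℝ) : ℂ) * K) = 1 := by
      rw [hK, show ((⌊t⌋ : ℝ) : ℂ) * (↑(wind g) * (2 * ↑Real.pi * I)) =
        ((⌊t⌋ * wind g : ℤ) : ℂ) * (2 * ↑Real.pi * I) by push_cast; ring]
      exact exp_int_mul_two_pi_mul_I _
    rw [this, mul_one]
    -- `g (fract t) = g t`
    rw [Int.fract, show t - ⌊t⌋ = t - (⌊t⌋ : ℤ) * (1 : ℝ) by ring]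
    exact hper.sub_int_mul_eq ⌊t⌋
  · simp only
    rw [Int.fract_add_intCast]
    push_cast
    ring

/-- **Degree of a reparametrised periodic loop**: for a continuous `1`-periodic nonvanishing
`g` and a continuous `Λ : [0, 1] → ℝ` with `Λ 1 = Λ 0 + m`, `m ∈ ℤ`, the loop `g ∘ Λ` has winding
number `m · wind g`. [folklore] -/
theorem wind_comp_eq_mul_of_periodic {g : ℝ → ℂ} (hg : Continuous g) (hper : Function.Periodic g 1)
    (hg0 : ∀ t, g t ≠ 0) {Λ : ℝ → ℝ} (hΛ : ContinuousOn Λ (Icc 0 1)) {m : ℤ}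
    (hm : Λ 1 = Λ 0 + m) : wind (fun t => g (Λ t)) = m * wind g := by
  obtain ⟨L, hLc, hLe, hLn⟩ := exists_log_of_periodic hg hper hg0
  have hl : ContinuousOn (fun t => L (Λ t)) (Icc 0 1) := hLc.comp_continuousOn hΛ
  have hle : ∀ t ∈ Icc (0 : ℝ) 1, exp (L (Λ t)) = g (Λ t) := fun t _ => hLe _
  have h01 : g (Λ 0) = g (Λ 1) := by
    rw [hm, show Λ 0 + (m : ℝ) = Λ 0 + (m : ℤ) * (1 : ℝ) by ring]
    exact (hper.int_mul m (Λ 0)).symm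
  have hspec := wind_spec (f := fun t => g (Λ t)) hl hle h01
  rw [hm, hLn] at hspec
  have h2 : (2 * Real.pi * I : ℂ) ≠ 0 := by simp [Real.pi_ne_zero, I_ne_zero]
  have : ((m * wind g : ℤ) : ℂ) * (2 * Real.pi * I) = (wind (fun t => g (Λ t)) : ℂ) * (2 * Real.pi * I) := by
    rw [← hspec]; push_cast; ring
  exact_mod_cast (mul_right_cancel₀ h2 this).symm

end Literature.Probability.RandomPlanarGeometry
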